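import Mathlib
import HarnessLib

/-!
# The Koszul identity behind infinitesimal rigidity: `h⁰ = 0 ⇒ h¹ = 0` for commuting isometries
# (route-independent helper toward the crux `TwistExponentGap.RigidTwistCeiling` ⟨stmt-QuantumFields-24054⟩; free hands of
# width seat ym-line-sfw-p2-w3)

After ✓p774936 / ✓p775025 / ✓p775240 / ✓p775343 the whole open content of ⟨24054⟩ is the LOCAL quadratic growth of the
`z`-twisted Wilson action off the gauge orbit of each twisted-flat configuration `U₀` — infinitesimal rigidity `h¹ = 0` made
quantitative in the exponential chart.  Its algebraic kernel is the vanishing of the first cohomology of `ℤⁿ` with coefficients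
in a finite-dimensional orthogonal representation WITHOUT invariant vectors: in the adjoint representation the holonomies of a
`z`-twisted flat connection are COMMUTING isometries `U₁,…,Uₙ` of `𝔤` (the twist `z` is central, `Ad z = 1`), pair-rigidity says
they have no joint fixed vector (`h⁰ = 0`), and then every Koszul 1-cocycle `(c_i)` — `(U_i − 1)c_j = (U_j − 1)c_i` — is a
coboundary `c_i = (U_i − 1)ξ` (`h¹ = 0`; on the torus `h¹ = n·h⁰` in general).  This file proves exactly that statement for any
finite family of pairwise commuting linear isometric automorphisms of a finite-dimensional real inner product space
(`exists_primitive_of_koszul_cocycle`), with the explicit mechanism `B = Σ_i (U_i⁻¹ − 1)(U_i − 1)`, `⟪B v, v⟫ = Σ_i ‖U_i v − v‖²`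
(so `B` is injective, hence bijective), `B ∘ (U_i − 1) = (U_i − 1) ∘ B`, and `(U_i − 1)(B⁻¹ Σ_j (U_j⁻¹ − 1) c_j) = c_i` by the
cocycle identity.  Index type arbitrary finite `ι`.
HONEST FRAMING: finite-dimensional linear algebra; the analytic half of the local inequality (tangent calculus of plaquette words,
comb-gauge reduction of lattice 1-cocycles to Koszul cocycles of the seam holonomies) is NOT here; nothing here bears on a summit
statement or on the Yang–Mills mass gap.
-/

set_option autoImplicit false

open scoped BigOperators RealInnerProductSpace

namespace Summit.QuantumFields.YangMills.Theorems.TwistExponentGap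

variable {V : Type*} [NormedAddCommGroup V] [InnerProductSpace ℝ V]

/-- For a linear isometric automorphism `U`: `⟪U⁻¹ a − a, v⟫ = ‖a‖²` when `a = U v − v`. -/
theorem inner_symm_sub_self_apply (U : V ≃ₗᵢ[ℝ] V) (v : V) :
    ⟪U.symm (U v - v) - (U v - v), v⟫ = ‖U v - v‖ ^ 2 := by
  have h1 : ⟪U.symm (U v - v), v⟫ = ⟪U v - v, U v⟫ := by
    rw [← U.inner_map_map (U.symm (U v - v)) v, U.apply_symm_apply]
  rw [inner_sub_left, h1, ← inner_sub_right, real_inner_self_eq_norm_sq]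

/-- Commuting isometric automorphisms: `U⁻¹` commutes with `W`. -/
theorem symm_apply_comm {U W : V ≃ₗᵢ[ℝ] V} (h : ∀ v, U (W v) = W (U v)) (v : V) :
    U.symm (W v) = W (U.symm v) := by
  apply U.injective
  rw [U.apply_symm_apply, h, U.apply_symm_apply]

/-- **Koszul 1-cocycles of commuting isometries without joint fixed vectors are coboundaries** (`h⁰ = 0 ⇒ h¹ = 0`).
For pairwise commuting linear isometric automorphisms `U_i` (`i ∈ ι` finite) of a finite-dimensional real inner product space
with `⋂_i ker(U_i − 1) = 0`, every family `c : ι → V` with `(U_i − 1) c_j = (U_j − 1) c_i` is of the form `c_i = (U_i − 1) ξ`. -/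
theorem exists_primitive_of_koszul_cocycle [FiniteDimensional ℝ V] {ι : Type*} [Fintype ι]
    (U : ι → V ≃ₗᵢ[ℝ] V) (hcomm : ∀ i j (v : V), U i (U j v) = U j (U i v))
    (hfix : ∀ v : V, (∀ i, U i v = v) → v = 0)
    (c : ι → V) (hcoc : ∀ i j, U i (c j) - c j = U j (c i) - c i) :
    ∃ ξ : V, ∀ i, c i = U i ξ - ξ := by
  classical
  -- `T_i = U_i − 1`, `S_i = U_i⁻¹ − 1`, `B = Σ_i S_i ∘ T_i`
  set T : ι → V →ₗ[ℝ] V := fun i => ((U i).toLinearEquiv : V →ₗ[ℝ] V) - LinearMap.id with hT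
  set S : ι → V →ₗ[ℝ] V := fun i => ((U i).symm.toLinearEquiv : V →ₗ[ℝ] V) - LinearMap.id with hS
  have hTapp : ∀ i (v : V), T i v = U i v - v := fun i v => rfl
  have hSapp : ∀ i (v : V), S i v = (U i).symm v - v := fun i v => rfl
  set B : V →ₗ[ℝ] V := ∑ i, (S i).comp (T i) with hB
  have hBapp : ∀ v : V, B v = ∑ i, S i (T i v) := fun v => by
    rw [hB, LinearMap.sum_apply]; rfl
  -- `⟪B v, v⟫ = Σ_i ‖U_i v − v‖²`
  have hBinner : ∀ v : V, ⟪B v, v⟫ = ∑ i, ‖U i v - v‖ ^ 2 := fun v => by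
    rw [hBapp, sum_inner]
    refine Finset.sum_congr rfl fun i _ => ?_
    rw [hSapp, hTapp]
    exact inner_symm_sub_self_apply (U i) v
  -- `B` is injective, hence surjective
  have hBinj : Function.Injective B := by
    rw [← LinearMap.ker_eq_bot, LinearMap.ker_eq_bot']
    intro v hv
    have hsum : ∑ i, ‖U i v - v‖ ^ 2 = 0 := by rw [← hBinner, hv, inner_zero_left]
    have heach : ∀ i, ‖U i v - v‖ ^ 2 = 0 := fun i =>
      (Finset.sum_eq_zero_iff_of_nonneg (fun j _ => sq_nonneg _)).1 hsum i (Finset.mem_univ i)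
    exact hfix v fun i => by
      have := heach i
      rw [sq_eq_zero_iff, norm_eq_zero, sub_eq_zero] at this
      exact this
  have hBsurj : Function.Surjective B := LinearMap.injective_iff_surjective.1 hBinj
  -- commutation relations
  have hTS : ∀ i j (v : V), T i (S j v) = S j (T i v) := fun i j v => by
    simp only [hTapp, hSapp, map_sub]
    rw [symm_apply_comm (fun x => (hcomm j i x))]
    abel
  have hTT : ∀ i j (v : V), T i (T j v) = T j (T i v) := fun i j v => by
    simp only [hTapp, map_sub, hcomm i j v]
    abel
  have hTB : ∀ i (v : V), T i (B v) = B (T i v) := fun i v => by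
    rw [hBapp, hBapp, map_sum]
    refine Finset.sum_congr rfl fun j _ => ?_
    rw [hTS, hTT]
  -- the primitive
  obtain ⟨ξ, hξ⟩ := hBsurj (∑ j, S j (c j))
  refine ⟨ξ, fun i => ?_⟩
  have hcoc' : ∀ j, T i (c j) = T j (c i) := fun j => by rw [hTapp, hTapp]; exact hcoc i j
  have key : B (T i ξ) = B (c i) := by
    rw [← hTB, hξ, map_sum, hBapp]
    refine Finset.sum_congr rfl fun j _ => ?_
    rw [hTS, hcoc' j]
  have := hBinj key
  rw [hTapp] at this
  exact this.symm

end Summit.QuantumFields.YangMills.Theorems.TwistExponentGap
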